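import Mathlib
import HarnessLib
import Summits.ValiantsHypothesis.ValiantsHypothesis.Theses.MonotoneRestoration
import Literature.Computability.AlgebraicComplexity.ArithCircuit
import Literature.Computability.AlgebraicComplexity.ArithCircuitProofs
import Literature.Computability.AlgebraicComplexity.MonotoneStructure
import Literature.Computability.AlgebraicComplexity.PermanentIrreducible
import Literature.ModelTheory.FiniteModelTheory.CkEquiv
import Summits.ValiantsHypothesis.ValiantsHypothesis.Theorems.MonotoneRestorationMonotoneRestorationQPCosetCount
import Summits.ValiantsHypothesis.ValiantsHypothesis.Theorems.MonotoneRestorationMonotoneRestorationQPSymmetricLB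
import Summits.ValiantsHypothesis.ValiantsHypothesis.Theorems.MonotoneRestorationMonotoneRestorationQPSupportSymmetrisation
import Summits.ValiantsHypothesis.ValiantsHypothesis.Theorems.MonotoneRestorationMonotoneRestorationQPSparseRegime
import Summits.ValiantsHypothesis.ValiantsHypothesis.Theorems.MonotoneRestorationMonotoneRestorationQPBeta
import Literature.Computability.AlgebraicComplexity.SymmetricArithCircuit
import Literature.Computability.AlgebraicComplexity.DawarWilsenach2025Proofs
import Literature.GroupTheory.PermutationGroups.SmallIndexSubgroups
import Summits.ValiantsHypothesis.ValiantsHypothesis.Theorems.MonotoneRestorationQP.Negative.LoadBearing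
import Summits.ValiantsHypothesis.ValiantsHypothesis.Theorems.MonotoneRestorationMonotoneRestorationQPPermSupportCount
import Summits.ValiantsHypothesis.ValiantsHypothesis.Theorems.MonotoneRestorationMonotoneRestorationQPMonotoneComputationOfComplexity

/-! TTRL-lite variant V14274 of stmt-ValiantsHypothesis-15886 -/

set_option linter.dupNamespace false

namespace Summit.ValiantsHypothesis.ValiantsHypothesis.Theorems

open Summit.ValiantsHypothesis.ValiantsHypothesis.Theses.MonotoneRestoration
open Literature.Computability.AlgebraicComplexity

/-- TTRL-lite variant V14274 (the target statement itself) of `stmt-ValiantsHypothesis-15886`: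
every `f : MvPolynomial σ ℝ≥0` has a Jerrum–Snir monotone computation (fan-in two, all sum
coefficients `1`) of size at most `3 · complexity f` — each weighted sum gate `c • u + d • v` of a
size-optimal fan-in-two circuit is expanded into `(c ⊗ u) ⊕ (d ⊗ v)`, three new gates per old
gate. Immediate from the tree's `stub_monotoneComputation_of_complexity`. [cite: JerrumSnir1982, §2.2] -/
theorem stub_monotoneComputation_of_complexity_var14274 :
    ∀ (σ : Type) (f : MvPolynomial σ NNReal), ∃ P : ArithCircuit NNReal σ,
      Literature.Barriers.ValiantsHypothesis.IsMonotoneComputation P f ∧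
      P.size ≤ 3 * complexity f :=
  fun _σ f => stub_monotoneComputation_of_complexity f

end Summit.ValiantsHypothesis.ValiantsHypothesis.Theorems
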